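import Summits.AtomisticToContinuum.Crystallization.Theorems.StackingFaultSparsity.Negative.BarlowWindow

/-!
# `StackingFaultSparsity` (stmt-AtomisticToContinuum-14296), negative side III: the dimer gas

Part III of the refuter's negative-side lemmas (I: `HcpTwin`, II: `BarlowWindow`).

* `dimerConfig` — the dimer gas: `N/2` vertical dimers of length `11/10`, consecutive dimers `10`
  apart; `dimer_bad` — every paired particle is Barlow-matched and not hcp-matched at
  `(R, ε) = (6/5, 1/100)`; `card_bad_even` — for even `N` all `N` particles are counted.
* `stackingFaultSparsity_false_without_groundState` — **the ground-state hypothesis is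
  load-bearing**: the crux with `∀ N, IsGroundState lennardJones (x N)` deleted
  (`StackingFaultSparsityWithoutGroundState`, verbatim otherwise) is FALSE (fraction `1` along even
  `N` for the dimer gas).  Any proof of the crux must use the ground-state property; the other
  hypotheses `0 < R`, `0 < ε`, `ε < 1/4` are inert (dropping them only adds parameter values at which
  the counted set is empty).
* `not_sameScaleBarlowToHcp` — the potential-free strengthening `SameScaleBarlowToHcp` ("at each
  fixed `(R, ε)` and for every sequence of configurations, Barlow windows a.e. ⇒ hcp windows a.e.") is
  FALSE (no particle of the dimer gas lacks a Barlow `(6/5, 1/100)`-window).  So a conditional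
  restatement `X → StackingFaultSparsity` (planner note S1 on the item) must feed in Barlow order at
  scales LARGER than the conclusion's `R` (as `LaminarBarlowWindows`, quantified over all `R`, does —
  the dimer gas has no Barlow window at any `R ≥ 2`) or the energetics; scale-local potential-free
  transfers aim at a false statement.
* `hcpMatched_of_le`, `card_bad_eq_zero_of_le` — the regime `R ≤ ε` is vacuous (every particle of
  every configuration is hcp-matched there), so the crux has content only for `R > ε`.
-/

noncomputable section

namespace Summit.AtomisticToContinuum.Crystallization.Theorems.StackingFaultSparsityNegative

open Literature.MathematicalPhysics.StatisticalMechanics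

/-! ## §3. The ground-state hypothesis is load-bearing: the dimer gas -/

/-- Site `n` of the dimer gas: `(10 ⌊n/2⌋, 0, 11/10 · (n mod 2))` — particles `2m`, `2m+1` form a
vertical dimer of length `11/10`, consecutive dimers are `10` apart. [new] -/
def dimerPos (n : ℕ) : E3 := !₂[10 * ((n / 2 : ℕ) : ℝ), 0, 11 / 10 * ((n % 2 : ℕ) : ℝ)]

/-- The dimer gas with `N` particles (the first `N` sites). [new] -/
def dimerConfig (N : ℕ) : Fin N → E3 := fun i => dimerPos i

/-- The upper site of a dimer is the lower one plus `(0, 0, 11/10)`. [folklore] -/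
theorem dimerPos_succ_of_even {n : ℕ} (hn : n % 2 = 0) :
    dimerPos (n + 1) = dimerPos n + !₂[0, 0, 11 / 10] := by
  have h1 : (n + 1) / 2 = n / 2 := by omega
  have h2 : (n + 1) % 2 = 1 := by omega
  ext l
  fin_cases l <;> simp [dimerPos, h1, h2, hn]

/-- Sites of different dimers are `≥ 10` apart (first coordinate). [folklore] -/
theorem div_two_eq_of_dist_lt {n n' : ℕ} (h : dist (dimerPos n') (dimerPos n) < 10) :
    n' / 2 = n / 2 := by
  by_contra hne
  have e0 : ∀ m : ℕ, (dimerPos m) 0 = 10 * ((m / 2 : ℕ) : ℝ) := fun m => by simp [dimerPos]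
  have h0 := PiLp.dist_apply_le (dimerPos n') (dimerPos n) 0
  rw [Real.dist_eq, e0, e0, ← mul_sub, abs_mul, abs_of_pos (by norm_num : (0 : ℝ) < 10)] at h0
  have h1 : (1 : ℝ) ≤ |((n' / 2 : ℕ) : ℝ) - ((n / 2 : ℕ) : ℝ)| := by
    rcases Nat.lt_or_gt_of_ne hne with hlt | hlt
    · have : ((n' / 2 : ℕ) : ℝ) + 1 ≤ ((n / 2 : ℕ) : ℝ) := by exact_mod_cast hlt
      rw [abs_sub_comm, abs_of_nonneg (by linarith)]
      linarith
    · have : ((n / 2 : ℕ) : ℝ) + 1 ≤ ((n' / 2 : ℕ) : ℝ) := by exact_mod_cast hlt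
      rw [abs_of_nonneg (by linarith)]
      linarith
  linarith

/-- **Every paired particle of the dimer gas is Barlow-matched and not hcp-matched** at
`(R, ε) = (6/5, 1/100)`. [new] -/
theorem dimer_bad {N : ℕ} (i : Fin N) (hpart : (i : ℕ) / 2 * 2 + 1 < N) :
    BarlowMatched (6 / 5) (1 / 100) (dimerConfig N) i ∧
      ¬ HcpMatched (6 / 5) (1 / 100) (dimerConfig N) i := by
  rcases Nat.even_or_odd (i : ℕ) with he | ho
  · -- lower particle, partner i + 1
    have hn : (i : ℕ) % 2 = 0 := Nat.even_iff.mp he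
    have hlt : (i : ℕ) + 1 < N := by omega
    set j₀ : Fin N := ⟨(i : ℕ) + 1, hlt⟩ with hj₀
    have hq : dimerConfig N j₀ = dimerConfig N i + !₂[0, 0, 11 / 10] := by
      simp only [dimerConfig, hj₀]
      exact dimerPos_succ_of_even hn
    have hiso : ∀ j : Fin N, dist (dimerConfig N j) (dimerConfig N i) < 10 →
        dimerConfig N j = dimerConfig N i ∨ dimerConfig N j = dimerConfig N j₀ := by
      intro j hj
      have hjj := div_two_eq_of_dist_lt hj
      have : (j : ℕ) = i ∨ (j : ℕ) = i + 1 := by omega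
      rcases this with h0 | h0
      · left; simp only [dimerConfig, h0]
      · right; simp only [dimerConfig, h0, hj₀]
    refine ⟨barlowMatched_of_dimer_up _ i j₀ hq hiso, not_hcpMatched_of_dimer _ i j₀ ?_ hiso⟩
    rw [hq, dist_comm, dist_eq_norm]
    simp [EuclideanSpace.norm_eq, Fin.sum_univ_three]
    norm_num
  · -- upper particle, partner i - 1
    have hn : (i : ℕ) % 2 = 1 := Nat.odd_iff.mp ho
    have hlt : (i : ℕ) - 1 < N := by omega
    set j₀ : Fin N := ⟨(i : ℕ) - 1, hlt⟩ with hj₀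
    have hq' : dimerConfig N i = dimerConfig N j₀ + !₂[0, 0, 11 / 10] := by
      simp only [dimerConfig, hj₀]
      have h0 : (i : ℕ) = ((i : ℕ) - 1) + 1 := by omega
      conv_lhs => rw [h0]
      exact dimerPos_succ_of_even (by omega)
    have hq : dimerConfig N j₀ = dimerConfig N i + !₂[0, 0, -(11 / 10)] := by
      rw [hq', add_assoc]
      have : (!₂[0, 0, 11 / 10] : E3) + !₂[0, 0, -(11 / 10)] = 0 := by
        ext l; fin_cases l <;> simp
      rw [this, add_zero]
    have hiso : ∀ j : Fin N, dist (dimerConfig N j) (dimerConfig N i) < 10 →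
        dimerConfig N j = dimerConfig N i ∨ dimerConfig N j = dimerConfig N j₀ := by
      intro j hj
      have hjj := div_two_eq_of_dist_lt hj
      have : (j : ℕ) = i ∨ (j : ℕ) = i - 1 := by omega
      rcases this with h0 | h0
      · left; simp only [dimerConfig, h0]
      · right; simp only [dimerConfig, h0, hj₀]
    refine ⟨barlowMatched_of_dimer_down _ i j₀ hq hiso, not_hcpMatched_of_dimer _ i j₀ ?_ hiso⟩
    rw [hq, dist_comm, dist_eq_norm]
    simp [EuclideanSpace.norm_eq, Fin.sum_univ_three]
    norm_num

/-- For even `N` every particle of the dimer gas is counted. [new] -/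
theorem card_bad_even (M : ℕ) :
    Nat.card {i : Fin (2 * M) // BarlowMatched (6 / 5) (1 / 100) (dimerConfig (2 * M)) i ∧
      ¬ HcpMatched (6 / 5) (1 / 100) (dimerConfig (2 * M)) i} = 2 * M := by
  have hall : ∀ i : Fin (2 * M), BarlowMatched (6 / 5) (1 / 100) (dimerConfig (2 * M)) i ∧
      ¬ HcpMatched (6 / 5) (1 / 100) (dimerConfig (2 * M)) i :=
    fun i => dimer_bad i (by have := i.isLt; omega)
  rw [Nat.card_congr (Equiv.subtypeUnivEquiv hall), Nat.card_eq_fintype_card, Fintype.card_fin]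

/-- The crux WITHOUT the hypothesis `∀ N, IsGroundState lennardJones (x N)` (verbatim otherwise):
the counted fraction should vanish for EVERY sequence of configurations. [new] -/
def StackingFaultSparsityWithoutGroundState : Prop :=
  ∀ R ε : ℝ, 0 < R → 0 < ε → ε < 1 / 4 → ∀ x : (N : ℕ) → (Fin N → EuclideanSpace ℝ (Fin 3)), Filter.Tendsto (fun N : ℕ => (Nat.card {i : Fin N // (∃ a h : ℝ, 1 / 2 < a ∧ a < 2 ∧ 1 / 2 < h ∧ h < 2 ∧ ∃ s : ℤ → ℤ, Literature.MathematicalPhysics.StatisticalMechanics.IsHaggSeq s ∧ ∃ z ∈ Literature.MathematicalPhysics.StatisticalMechanics.barlowStacking a h s, ∃ A : EuclideanSpace ℝ (Fin 3) →ₗᵢ[ℝ] EuclideanSpace ℝ (Fin 3), (∀ p ∈ Literature.MathematicalPhysics.StatisticalMechanics.barlowStacking a h s, dist p z ≤ R → ∃ j : Fin N, dist (x N j) (x N i + A (p - z)) ≤ ε) ∧ (∀ j : Fin N, dist (x N j) (x N i) ≤ R → ∃ p ∈ Literature.MathematicalPhysics.StatisticalMechanics.barlowStacking a h s, dist (x N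 j) (x N i + A (p - z)) ≤ ε)) ∧ ¬ (∃ a h : ℝ, 1 / 2 < a ∧ a < 2 ∧ 1 / 2 < h ∧ h < 2 ∧ ∃ z ∈ Literature.MathematicalPhysics.StatisticalMechanics.hcpStacking a h, ∃ A : EuclideanSpace ℝ (Fin 3) →ₗᵢ[ℝ] EuclideanSpace ℝ (Fin 3), (∀ p ∈ Literature.MathematicalPhysics.StatisticalMechanics.hcpStacking a h, dist p z ≤ R → ∃ j : Fin N, dist (x N j) (x N i + A (p - z)) ≤ ε) ∧ (∀ j : Fin N, dist (x N j) (x N i) ≤ R → ∃ p ∈ Literature.MathematicalPhysics.StatisticalMechanics.hcpStacking a h, dist (x N j) (x N i + A (p - z)) ≤ ε))} : ℝ) / N) Filter.atTop (nhds 0)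

/-- The GS-free statement with the abbreviations (`Iff.rfl`). [folklore] -/
theorem stackingFaultSparsityWithoutGroundState_iff :
    StackingFaultSparsityWithoutGroundState ↔
      ∀ R ε : ℝ, 0 < R → 0 < ε → ε < 1 / 4 → ∀ x : (N : ℕ) → (Fin N → E3),
        Filter.Tendsto (fun N : ℕ =>
          (Nat.card {i : Fin N // BarlowMatched R ε (x N) i ∧ ¬ HcpMatched R ε (x N) i} : ℝ) / N)
          Filter.atTop (nhds 0) :=
  Iff.rfl

/-- Along even `N` the counted fraction of the dimer gas is identically `1`, so it does not tend
to `0`. [new] -/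
theorem not_tendsto_dimerConfig :
    ¬ Filter.Tendsto (fun N : ℕ =>
        (Nat.card {i : Fin N // BarlowMatched (6 / 5) (1 / 100) (dimerConfig N) i ∧
          ¬ HcpMatched (6 / 5) (1 / 100) (dimerConfig N) i} : ℝ) / N)
        Filter.atTop (nhds 0) := by
  intro h
  have hsub : Filter.Tendsto (fun M : ℕ => 2 * (M + 1)) Filter.atTop Filter.atTop :=
    Filter.tendsto_atTop_atTop.2 fun b => ⟨b, fun M hM => by omega⟩
  have h2 := h.comp hsub
  have h3 : (fun N : ℕ =>
        (Nat.card {i : Fin N // BarlowMatched (6 / 5) (1 / 100) (dimerConfig N) i ∧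
          ¬ HcpMatched (6 / 5) (1 / 100) (dimerConfig N) i} : ℝ) / N) ∘ (fun M : ℕ => 2 * (M + 1)) =
      fun _ => (1 : ℝ) := by
    funext M
    simp only [Function.comp_apply]
    rw [card_bad_even (M + 1)]
    have : ((2 * (M + 1) : ℕ) : ℝ) ≠ 0 := by positivity
    exact div_self this
  rw [h3] at h2
  have := tendsto_nhds_unique h2 tendsto_const_nhds
  norm_num at this

/-- **`IsGroundState` is load-bearing: the crux with the ground-state hypothesis dropped is false.**
Witness: the dimer gas at `(R, ε) = (6/5, 1/100)`. So no argument about Barlow/hcp windows that is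
blind to the energy (or to Barlow order at larger scales) can prove the crux. [new] -/
theorem stackingFaultSparsity_false_without_groundState : ¬ StackingFaultSparsityWithoutGroundState := by
  rw [stackingFaultSparsityWithoutGroundState_iff]
  intro H
  exact not_tendsto_dimerConfig (H (6 / 5) (1 / 100) (by norm_num) (by norm_num) (by norm_num) dimerConfig)

/-! ## §4. A refuted strengthening: no scale-by-scale transfer from Barlow to hcp windows -/

/-- Every particle of the dimer gas (paired or, for odd `N`, the last unpaired one) is
Barlow-matched at `(6/5, 1/100)`. [new] -/
theorem dimerConfig_barlowMatched {N : ℕ} (i : Fin N) :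
    BarlowMatched (6 / 5) (1 / 100) (dimerConfig N) i := by
  by_cases hpart : (i : ℕ) / 2 * 2 + 1 < N
  · exact (dimer_bad i hpart).1
  · apply barlowMatched_of_isolated
    intro j hj
    have hjj := div_two_eq_of_dist_lt hj
    have h1 := j.isLt
    have h2 := i.isLt
    have : (j : ℕ) = i := by omega
    simp only [dimerConfig, this]

/-- SAME-SCALE TRANSFER (a natural strengthening / the naive conditional form of the crux): at each
fixed `(R, ε)`, for EVERY sequence of configurations, "all but `o(N)` particles have a Barlow
`(R, ε)`-window" implies "all but `o(N)` of the Barlow-matched particles have an hcp `(R, ε)`-window".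
[new] -/
def SameScaleBarlowToHcp : Prop :=
  ∀ R ε : ℝ, 0 < R → 0 < ε → ε < 1 / 4 → ∀ x : (N : ℕ) → (Fin N → E3),
    Filter.Tendsto (fun N : ℕ => (Nat.card {i : Fin N // ¬ BarlowMatched R ε (x N) i} : ℝ) / N)
      Filter.atTop (nhds 0) →
    Filter.Tendsto (fun N : ℕ =>
      (Nat.card {i : Fin N // BarlowMatched R ε (x N) i ∧ ¬ HcpMatched R ε (x N) i} : ℝ) / N)
      Filter.atTop (nhds 0)

/-- **The same-scale transfer is false** (dimer gas: no particle lacks a Barlow `(6/5,1/100)`-window,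
all paired particles lack an hcp one).  Hence a conditional restatement `X → StackingFaultSparsity`
must feed in Barlow order at scales LARGER than the conclusion's `R` (as `LaminarBarlowWindows`, which
quantifies over all `R`, does) or the energy; potential-free and scale-local arguments aim at a false
statement. [new] -/
theorem not_sameScaleBarlowToHcp : ¬ SameScaleBarlowToHcp := by
  intro H
  refine not_tendsto_dimerConfig (H (6 / 5) (1 / 100) (by norm_num) (by norm_num) (by norm_num)
    dimerConfig ?_)
  have h0 : (fun N : ℕ =>
      (Nat.card {i : Fin N // ¬ BarlowMatched (6 / 5) (1 / 100) (dimerConfig N) i} : ℝ) / N) =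
      fun _ => (0 : ℝ) := by
    funext N
    have : Nat.card {i : Fin N // ¬ BarlowMatched (6 / 5) (1 / 100) (dimerConfig N) i} = 0 :=
      Nat.card_eq_zero.mpr (Or.inl ⟨fun ⟨i, hi⟩ => hi (dimerConfig_barlowMatched i)⟩)
    rw [this]
    simp
  rw [h0]
  exact tendsto_const_nhds

/-! ## §5. Vacuous regime `R ≤ ε`: there the counted set is empty for EVERY configuration -/

/-- For `R ≤ ε` (automatic in part of the crux's parameter range, since only `0 < R` and
`0 < ε < 1/4` are asked) every particle of every configuration is hcp-matched: with `a = h = 199/100`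
the `R`-window of a site is the site alone (`R ≤ ε < 1/4 < 199/100`) and every particle within `R` of
`X i` is within `ε` of the centre's image.  So the crux has content only for `R > ε`. [folklore] -/
theorem hcpMatched_of_le {N : ℕ} (X : Fin N → E3) (i : Fin N) {R ε : ℝ} (hRε : R ≤ ε)
    (hR : R < 199 / 100) : HcpMatched R ε X i := by
  refine ⟨199 / 100, 199 / 100, by norm_num, by norm_num, by norm_num, by norm_num,
    barlowPos (199 / 100) (199 / 100) alternatingHagg 0 0 0, barlowPos_mem _ _ _,
    LinearIsometry.id, ?_, ?_⟩
  · intro p hp hpd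
    refine ⟨i, ?_⟩
    have : p = barlowPos (199 / 100) (199 / 100) alternatingHagg 0 0 0 := by
      by_contra hne
      have := le_dist_of_mem_barlowStacking (199 / 100) (199 / 100) alternatingHagg (by norm_num)
        (by norm_num) hp (barlowPos_mem 0 0 0) hne
      rw [min_self] at this
      linarith
    rw [this]
    have : (0 : ℝ) ≤ ε := dist_nonneg.trans (hpd.trans hRε)
    simpa using this
  · intro j hj
    exact ⟨_, barlowPos_mem 0 0 0, by simpa using hj.trans hRε⟩

/-- Hence for `R ≤ ε < 1/4` the counted set of the crux is empty, whatever the configuration. [folklore] -/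
theorem card_bad_eq_zero_of_le {N : ℕ} (X : Fin N → E3) {R ε : ℝ} (hRε : R ≤ ε) (hε : ε < 1 / 4) :
    Nat.card {i : Fin N // BarlowMatched R ε X i ∧ ¬ HcpMatched R ε X i} = 0 :=
  Nat.card_eq_zero.mpr (Or.inl ⟨fun ⟨i, hi⟩ => hi.2 (hcpMatched_of_le X i hRε (by linarith))⟩)

end Summit.AtomisticToContinuum.Crystallization.Theorems.StackingFaultSparsityNegative

end
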